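import Summits.QuantumFields.YangMills.Theorems.BalabanUVNodesN21GappedPairRoadRStepNeutral
import Summits.QuantumFields.YangMills.Theorems.BalabanUVNodesN21GappedTopReading13CoPHSanity

/-!
# N21 (NE7c) · THE DOUBLY-GAPPED READING — SANITY (A-guards): at EQUAL letters BOTH open collars are empty and the two-collar shell VANISHES (at the run's top the doubly-gapped
# step weights ARE the pair-lettered step weights); at the (3.3) letter OF RECORD `2δ_k` the pair objects ARE the lane owner's single-gap objects (U1); at ZERO widths the
# reading's shell parts vanish identically; depth budgets `0` select depths `0`; the reading shares every non-weight field with dag-n20-d's `crOfRecord₁₃VAt` (`rfl`), and its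
# cores ARE the keyed doubly-gapped cores `gapCore2A₁₃ ∕ gapCore2B₁₃`

WIDTH SEAT `pub-ymgap-dag-n21-w7` (g3), node N21 = NE7c (NOT PRINTED; NOT proved at print's fixed thresholds); lane K3⁸ `SpineGivenEndpointR13SepCoPHV`
(stmt-QuantumFields-27366, `--supports … --as helper`; COUNT-NEUTRAL).  THEOREMS ONLY (0 `def`).  g2's successor trigger (t4); the PAIR twin of the lane owner dag-n21-d's
U7 `…GappedTopReading13CoPHSanity` (`wGapAt_self_top`, `topGapShellAt_self_eq_zero`, R4 `cutGrid_width_zero`), which is imported together with its V5b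
`…GappedPairRoadRStepNeutral` (p635796: `bCutGrid_width_zero`; through it this seat's definition lane `…GappedTopPairReading13CoPHDefs` p631127 and part 2 `…SlotDefs` p626059:
`wTop2At ∕ topSlot2At ∕ topClassWeight2At`, `wGap2At ∕ topGap2SlotAt∕CoreAt∕ShellAt`, `ωGap2At_self ∕ ωGap2At_selfB`, `selDepthA2₁₃ ∕ B2₁₃`, `gapShell2A₁₃ ∕ B₁₃`,
`gapCore2A₁₃ ∕ B₁₃`, `crGap2₁₃VAt`).

WHAT THIS FILE PROVES (theorems only; 0 `def`).
* §S1 (NODE 00's generality) ★ `wGap2At_self_top` (`k + 1 = p.K ⇒ wGap2(θ,θ;δ′,δ′) = wTop2(θ,δ′)`), `topGap2SlotAt_self`, `topGap2CoreAt_self`, ★ `topGap2ShellAt_self_eq_zero`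
  (BOTH collars empty ⇒ the two-collar shell VANISHES), `topGap2ShellAtLevel_self_eq_zero`; at the (3.3) letter of record: `topBLetter_twoDelta`, `wTop2At_twoDelta_eq_wTopAt`,
  `wGap2At_twoDelta_eq_wGapAt`, `topSlot2At_twoDelta_eq_topSlotAt`, `topClassWeight2At_twoDelta_eq_topClassWeightAt`, `topGap2SlotAt_twoDelta_eq_topGapSlotAt`,
  `topGap2CoreAt_twoDelta_eq_topGapCoreAt`, ★ `topGap2ShellAt_twoDelta_eq_topGapShellAt` (the pair objects with the (3.3) collar closed onto print's `2δ_k` ARE U1's objects —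
  every step, any (3.2) letters).
* §S2 (at the reading) ★ `gapShell2A₁₃_eq_zero_of_widths_zero` ∕ `gapShell2B₁₃_eq_zero_of_widths_zero` (`ρ_K = 0 = ρ′_K`), `selDepthA2₁₃_budget_zero` ∕ `selDepthB2₁₃_budget_zero`;
  the `rfl` dictionary `crGap2₁₃VAt_{T,Bad,vol,l₀,K₀}_eq` against `crOfRecord₁₃VAt`; ★★ `crGap2₁₃VAt_core_eq`.

HONEST FRAMING (binding).  A-guards only: the degenerate instances (equal letters, the (3.3) letter of record, `ρ_K = ρ′_K = 0`, `n = 0`) are the theorems' subjects; the content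
regime `0 < ρ_K, ρ′_K < 1`, `n ≥ 1` is the subject of FILE 14∕15 and their sign-free editions; NO estimate; NE7c NOT PRINTED ∕ NOT proved at print's thresholds; N21 NOT
discharged; K3⁸ NOT claimed; counts UNMOVED (typed 28∕28 · discharged 5∕27); never a count claim.  No `instance`, no `notation`, no `def`.  One finite four-torus programme at
fixed `ε` — NOT ℝ⁴, NOT OS, NOT a mass gap, NOT the Clay problem.
-/

noncomputable section

open scoped BigOperators
open Finset MeasureTheory

namespace Summit.QuantumFields.YangMills.Theorems.N21GappedTopPair13CoPH

open Literature.MathematicalPhysics.QuantumFieldTheory.Balaban1983to89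
open Literature.MathematicalPhysics.QuantumFieldTheory.Balaban1983to89.T4Continuum
open Literature.MathematicalPhysics.QuantumFieldTheory.Balaban1983to89.Node00
open YMDAG.UVSplit (SpineReading₁₃CoPH ShellSplit₁₃CoPH crOfRecord₁₃VAt keyA₁₃ keyB₁₃ runA₁₃ runB₁₃ histA₁₃ histB₁₃ classSet₁₃ badClass₁₃)
open Summit.QuantumFields.YangMills.Theorems.N21ShellSplitOfRecord13CoPH

/-! ## §S1 At equal letters: both collars empty, the two-collar shell vanishes; at the (3.3) letter of record: the pair objects are U1's single-gap objects -/

section Generality2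

variable (F : T4Family) (N : ℕ) [NeZero N] (ϑ : Stage9Params F N) (D : FiniteEpsData F (SU N)) (g₀ : ℕ → ℝ) (os : List (ULoop F))
  (p : B12.RunParams) (g : ℕ → ℝ) (k : ℕ)

/-- ★ **AT EQUAL LETTERS AND AT THE RUN's TOP THE DOUBLY-GAPPED STEP WEIGHTS ARE THE PAIR-LETTERED STEP WEIGHTS**: `k + 1 = p.K ⇒ wGap2(θ, θ; δ′, δ′) p g k = wTop2(θ, δ′) p g k`
(`ωGap2At_self` inside the resummation). [bookkeeping] -/
theorem wGap2At_self_top (hk : k + 1 = p.K) (θ δ' : ℝ) : wGap2At F N ϑ θ θ δ' δ' p g k = wTop2At F N ϑ θ δ' p g k := by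
  rw [wGap2At_apply, wTop2At_apply_top F N ϑ p g k hk, ωGap2At_self]

/-- at equal letters and at the top the doubly-gapped top slot IS the pair-lettered slot. [bookkeeping] -/
theorem topGap2SlotAt_self (hk : k + 1 = p.K) (θ δ' t : ℝ) (s' : SeqOfRecord F ϑ.ν ϑ.τ9.M g p.K (k + 1)) :
    topGap2SlotAt F N ϑ D g₀ os p g k θ θ δ' δ' t s' = topSlot2At F N ϑ D g₀ os p g k θ δ' t s' := by
  funext V
  rw [topGap2SlotAt_apply, topSlot2At_apply, wGap2At_self_top F N ϑ p g k hk θ δ']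

/-- at equal letters and at the top the doubly-gapped core IS the pair-lettered class weight. [bookkeeping] -/
theorem topGap2CoreAt_self (hk : k + 1 = p.K) (θ δ' t : ℝ) (s' : SeqOfRecord F ϑ.ν ϑ.τ9.M g p.K (k + 1)) :
    topGap2CoreAt F N ϑ D g₀ os p g k θ θ δ' δ' t s' = topClassWeight2At F N ϑ D g₀ os p g k θ δ' t s' := by
  unfold topGap2CoreAt topClassWeight2At
  exact integral_congr_ae (ae_of_all _ fun V => by rw [topGap2SlotAt_self F N ϑ D g₀ os p g k hk θ δ' t s'])

/-- ★ **AT EQUAL LETTERS THE TWO-COLLAR SHELL VANISHES** (at the run's top): both open collars `(θ, θ)`, `(δ′, δ′)` are empty and carry no mass. [bookkeeping] -/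
theorem topGap2ShellAt_self_eq_zero (hk : k + 1 = p.K) (θ δ' t : ℝ) (s' : SeqOfRecord F ϑ.ν ϑ.τ9.M g p.K (k + 1)) :
    topGap2ShellAt F N ϑ D g₀ os p g k θ θ θ δ' δ' δ' t s' = 0 := by
  rw [topGap2ShellAt, topGap2CoreAt_self F N ϑ D g₀ os p g k hk θ δ' t s', sub_self]

variable {k} in
/-- the same at every level `j = p.K`. [bookkeeping] -/
theorem topGap2ShellAtLevel_self_eq_zero (θ δ' t : ℝ) :
    ∀ (j : ℕ), j = p.K → ∀ s : SeqOfRecord F ϑ.ν ϑ.τ9.M g p.K j, topGap2ShellAtLevel F N ϑ D g₀ os p g θ θ θ δ' δ' δ' t j s = 0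
  | 0, _, _ => rfl
  | k + 1, hk, s' => topGap2ShellAt_self_eq_zero F N ϑ D g₀ os p g k hk θ δ' t s'

/-- at the (3.3) letter of record the top (3.3) letter reads print's `2δ_k` (both branches). [bookkeeping] -/
theorem topBLetter_twoDelta : topBLetter F N ϑ (twoDeltaLetterOfRecord ϑ.ν ϑ.A₁ p g k) p g k = twoDeltaLetterOfRecord ϑ.ν ϑ.A₁ p g k := by
  unfold topBLetter
  split_ifs <;> rfl

/-- at the (3.3) letter of record the pair-lettered step weights ARE T1's top-lettered step weights (every step, any (3.2) letter). [bookkeeping] -/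
theorem wTop2At_twoDelta_eq_wTopAt (θ : ℝ) : wTop2At F N ϑ θ (twoDeltaLetterOfRecord ϑ.ν ϑ.A₁ p g k) p g k = wTopAt F N ϑ θ p g k := by
  unfold wTop2At wTopAt
  rw [wOfRecordAt_apply, wOfRecordAt_apply, topBLetter_twoDelta]

/-- at the (3.3) letter of record the doubly-gapped step weights ARE the lane owner's gapped step weights U1 `wGapAt` (`ωGap2At_selfB` inside the resummation; every step).
[bookkeeping] -/
theorem wGap2At_twoDelta_eq_wGapAt (θlo θhi : ℝ) :
    wGap2At F N ϑ θlo θhi (twoDeltaLetterOfRecord ϑ.ν ϑ.A₁ p g k) (twoDeltaLetterOfRecord ϑ.ν ϑ.A₁ p g k) p g k = wGapAt F N ϑ θlo θhi p g k := by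
  rw [wGap2At_apply, wGapAt_apply, ωGap2At_selfB]

/-- at the (3.3) letter of record the pair-lettered slot IS T1's top-lettered slot. [bookkeeping] -/
theorem topSlot2At_twoDelta_eq_topSlotAt (θ t : ℝ) (s' : SeqOfRecord F ϑ.ν ϑ.τ9.M g p.K (k + 1)) :
    topSlot2At F N ϑ D g₀ os p g k θ (twoDeltaLetterOfRecord ϑ.ν ϑ.A₁ p g k) t s' = topSlotAt F N ϑ D g₀ os p g k θ t s' := by
  funext V
  rw [topSlot2At_apply, topSlotAt_apply, wTop2At_twoDelta_eq_wTopAt]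

/-- at the (3.3) letter of record the pair-lettered class weight IS T1's top-lettered class weight. [bookkeeping] -/
theorem topClassWeight2At_twoDelta_eq_topClassWeightAt (θ t : ℝ) (s' : SeqOfRecord F ϑ.ν ϑ.τ9.M g p.K (k + 1)) :
    topClassWeight2At F N ϑ D g₀ os p g k θ (twoDeltaLetterOfRecord ϑ.ν ϑ.A₁ p g k) t s' = topClassWeightAt F N ϑ D g₀ os p g k θ t s' := by
  unfold topClassWeight2At topClassWeightAt
  exact integral_congr_ae (ae_of_all _ fun V => by rw [topSlot2At_twoDelta_eq_topSlotAt F N ϑ D g₀ os p g k θ t s'])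

/-- at the (3.3) letter of record the doubly-gapped top slot IS U1's gapped top slot. [bookkeeping] -/
theorem topGap2SlotAt_twoDelta_eq_topGapSlotAt (θlo θhi t : ℝ) (s' : SeqOfRecord F ϑ.ν ϑ.τ9.M g p.K (k + 1)) :
    topGap2SlotAt F N ϑ D g₀ os p g k θlo θhi (twoDeltaLetterOfRecord ϑ.ν ϑ.A₁ p g k) (twoDeltaLetterOfRecord ϑ.ν ϑ.A₁ p g k) t s' =
      topGapSlotAt F N ϑ D g₀ os p g k θlo θhi t s' := by
  funext V
  rw [topGap2SlotAt_apply, topGapSlotAt_apply, wGap2At_twoDelta_eq_wGapAt]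

/-- at the (3.3) letter of record the doubly-gapped core IS U1's gapped core. [bookkeeping] -/
theorem topGap2CoreAt_twoDelta_eq_topGapCoreAt (θlo θhi t : ℝ) (s' : SeqOfRecord F ϑ.ν ϑ.τ9.M g p.K (k + 1)) :
    topGap2CoreAt F N ϑ D g₀ os p g k θlo θhi (twoDeltaLetterOfRecord ϑ.ν ϑ.A₁ p g k) (twoDeltaLetterOfRecord ϑ.ν ϑ.A₁ p g k) t s' =
      topGapCoreAt F N ϑ D g₀ os p g k θlo θhi t s' := by
  unfold topGap2CoreAt topGapCoreAt
  exact integral_congr_ae (ae_of_all _ fun V => by rw [topGap2SlotAt_twoDelta_eq_topGapSlotAt F N ϑ D g₀ os p g k θlo θhi t s'])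

/-- ★ **AT THE (3.3) LETTER OF RECORD THE TWO-COLLAR SHELL IS THE LANE OWNER's COLLAR SHELL** U1 `topGapShellAt` (the (3.3) collar closed onto print's `2δ_k`; every step, any
(3.2) letters `θlo, θ, θhi`). [bookkeeping] -/
theorem topGap2ShellAt_twoDelta_eq_topGapShellAt (θlo θ θhi t : ℝ) (s' : SeqOfRecord F ϑ.ν ϑ.τ9.M g p.K (k + 1)) :
    topGap2ShellAt F N ϑ D g₀ os p g k θlo θ θhi (twoDeltaLetterOfRecord ϑ.ν ϑ.A₁ p g k) (twoDeltaLetterOfRecord ϑ.ν ϑ.A₁ p g k)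
        (twoDeltaLetterOfRecord ϑ.ν ϑ.A₁ p g k) t s' =
      topGapShellAt F N ϑ D g₀ os p g k θlo θ θhi t s' := by
  rw [topGap2ShellAt, topGapShellAt, topClassWeight2At_twoDelta_eq_topClassWeightAt, topGap2CoreAt_twoDelta_eq_topGapCoreAt]

end Generality2

/-! ## §S2 At the reading: zero widths ⇒ zero shell parts; budget `0` ⇒ depth `0`; the `rfl` dictionary against n20-d's reading; the cores -/

section Reading2S

variable {F : T4Family} {N : ℕ} [NeZero N]

/-- ★ **AT ZERO WIDTHS RUN A's TWO-COLLAR SHELL PART VANISHES IDENTICALLY** (every key, every depth budgets): all three (3.2) letters are the run's own `ε`, all three (3.3)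
letters its own `2δ`, both collars are empty — the zero-widths instance of the reading is the zero split (A6: the content regime is `0 < ρ_K, ρ′_K`). [bookkeeping] -/
theorem gapShell2A₁₃_eq_zero_of_widths_zero (θ : Stage13HParams F N) (hP : θ.Provisos₁₃CoPH F N) (K₀ : ℕ) (g₀ : ℕ → ℝ) (os : List (ULoop F)) {ρ ρ' : ℕ → ℝ}
    (n₁ n₂ : ℕ → ℕ) {K : ℕ} (hρ : ρ K = 0) (hρ' : ρ' K = 0) (t : ℝ) (x : Σ K, SiteSeqKey F (K₀ + K)) :
    gapShell2A₁₃ θ hP K₀ g₀ os ρ ρ' n₁ n₂ K t x = 0 := by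
  letI : ∀ Kc, DecidableEq (SiteSeqKey F Kc) := fun _ => Classical.decEq _
  unfold gapShell2A₁₃
  refine Finset.sum_eq_zero fun s _ => ?_
  rw [hρ, hρ', cutGrid_width_zero, cutGrid_width_zero, cutGrid_width_zero, bCutGrid_width_zero, bCutGrid_width_zero, bCutGrid_width_zero]
  exact topGap2ShellAtLevel_self_eq_zero F N θ.toStage9Params (datumOfRecord₁₃CoPH F N θ hP) g₀ os (runA₁₃ F K₀ g₀ K) (histA₁₃ θ K₀ g₀ K) _ _ t _
    (YMDAG.UVSplit.runA₁₃_K F K₀ g₀ K).symm s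

/-- ★ **… AND RUN B's.** [bookkeeping] -/
theorem gapShell2B₁₃_eq_zero_of_widths_zero (θ : Stage13HParams F N) (hP : θ.Provisos₁₃CoPH F N) (K₀ : ℕ) (g₀ : ℕ → ℝ) (os : List (ULoop F)) {ρ ρ' : ℕ → ℝ}
    (n₁ n₂ : ℕ → ℕ) {K : ℕ} (hρ : ρ K = 0) (hρ' : ρ' K = 0) (t : ℝ) (x : Σ K, SiteSeqKey F (K₀ + K)) :
    gapShell2B₁₃ θ hP K₀ g₀ os ρ ρ' n₁ n₂ K t x = 0 := by
  letI : ∀ Kc, DecidableEq (SiteSeqKey F Kc) := fun _ => Classical.decEq _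
  unfold gapShell2B₁₃
  refine Finset.sum_eq_zero fun s' _ => ?_
  rw [hρ, hρ', cutGrid_width_zero, cutGrid_width_zero, cutGrid_width_zero, bCutGrid_width_zero, bCutGrid_width_zero, bCutGrid_width_zero]
  exact topGap2ShellAtLevel_self_eq_zero F N θ.toStage9Params (datumOfRecord₁₃CoPH F N θ hP) g₀ os (runB₁₃ F K₀ g₀ K) (histB₁₃ θ K₀ g₀ K) _ _ t _
    (YMDAG.UVSplit.runB₁₃_K F K₀ g₀ K).symm s'

/-- **(3.2) DEPTH BUDGET `0` SELECTS DEPTH `0`** — the selected middle (3.2) letter is then `ε(1 − ρ_K)`. [bookkeeping] -/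
theorem selDepthA2₁₃_budget_zero (θ : Stage13HParams F N) (hP : θ.Provisos₁₃CoPH F N) (K₀ : ℕ) (g₀ : ℕ → ℝ) (os : List (ULoop F)) (ρ : ℕ → ℝ) (K : ℕ) (t : ℝ) :
    selDepthA2₁₃ θ hP K₀ g₀ os ρ 0 K t = 0 :=
  Nat.le_zero.1 (selDepthA2₁₃_le θ hP K₀ g₀ os ρ 0 K t)

/-- **(3.3) DEPTH BUDGET `0` SELECTS DEPTH `0`** — the selected middle (3.3) letter is then `2δ(1 − ρ′_K)`. [bookkeeping] -/
theorem selDepthB2₁₃_budget_zero (θ : Stage13HParams F N) (hP : θ.Provisos₁₃CoPH F N) (K₀ : ℕ) (g₀ : ℕ → ℝ) (os : List (ULoop F)) (ρ' : ℕ → ℝ) (K : ℕ) (t : ℝ) :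
    selDepthB2₁₃ θ hP K₀ g₀ os ρ' 0 K t = 0 :=
  Nat.le_zero.1 (selDepthB2₁₃_le θ hP K₀ g₀ os ρ' 0 K t)

/-! ### The doubly-gapped reading shares every non-weight field with dag-n20-d's `crOfRecord₁₃VAt` (`rfl`) -/

section Dictionary2S

variable (K₀ : ℕ) (jcut : ℕ → ℕ) (sh : ShellSplit₁₃CoPH N K₀) (ρ ρ' : WidthLetter₁₃CoPH N) (n₁ n₂ : DepthLetter₁₃CoPH N) (θ : Stage13HParams F N)
  (hP : θ.Provisos₁₃CoPH F N) (g₀ : ℕ → ℝ) (os : List (ULoop F))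

/-- same class set. [bookkeeping] -/
theorem crGap2₁₃VAt_T_eq : (crGap2₁₃VAt N K₀ jcut ρ ρ' n₁ n₂ F θ hP g₀ os).T = (crOfRecord₁₃VAt K₀ jcut sh F θ hP g₀ os).T := rfl
/-- same bad class. [bookkeeping] -/
theorem crGap2₁₃VAt_Bad_eq : (crGap2₁₃VAt N K₀ jcut ρ ρ' n₁ n₂ F θ hP g₀ os).Bad = (crOfRecord₁₃VAt K₀ jcut sh F θ hP g₀ os).Bad := rfl
/-- same volume letter. [bookkeeping] -/
theorem crGap2₁₃VAt_vol_eq : (crGap2₁₃VAt N K₀ jcut ρ ρ' n₁ n₂ F θ hP g₀ os).vol = (crOfRecord₁₃VAt K₀ jcut sh F θ hP g₀ os).vol := rfl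
/-- same `l₀`. [bookkeeping] -/
theorem crGap2₁₃VAt_l₀_eq : (crGap2₁₃VAt N K₀ jcut ρ ρ' n₁ n₂ F θ hP g₀ os).l₀ = (crOfRecord₁₃VAt K₀ jcut sh F θ hP g₀ os).l₀ := rfl
/-- same offset. [bookkeeping] -/
theorem crGap2₁₃VAt_K₀_eq : (crGap2₁₃VAt N K₀ jcut ρ ρ' n₁ n₂ F θ hP g₀ os).K₀ = (crOfRecord₁₃VAt K₀ jcut sh F θ hP g₀ os).K₀ := rfl

/-- ★★ **THE DOUBLY-GAPPED READING's CORES `A − shA`, `B − shB` ARE THE KEYED DOUBLY-GAPPED CORES** `gapCore2A₁₃ ∕ gapCore2B₁₃`, identically: what `KeyedCoreEdgeHolderD4V`-shaped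
consumers match at this reading — the (2.18) terms with NO top (3.2) statistic in `(θ_{i⋆+2}, θ_{i⋆})` and NO top (3.3) statistic in `(δ′_{j⋆+2}, δ′_{j⋆})`. [bookkeeping] -/
theorem crGap2₁₃VAt_core_eq (K : ℕ) (t : ℝ) (x : Σ K, SiteSeqKey F (K₀ + K)) :
    (crGap2₁₃VAt N K₀ jcut ρ ρ' n₁ n₂ F θ hP g₀ os).A K t x - (crGap2₁₃VAt N K₀ jcut ρ ρ' n₁ n₂ F θ hP g₀ os).shA K t x =
        gapCore2A₁₃ θ hP K₀ g₀ os (ρ F θ hP g₀ os) (ρ' F θ hP g₀ os) (n₁ F θ hP g₀ os) (n₂ F θ hP g₀ os) K t x ∧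
      (crGap2₁₃VAt N K₀ jcut ρ ρ' n₁ n₂ F θ hP g₀ os).B K t x - (crGap2₁₃VAt N K₀ jcut ρ ρ' n₁ n₂ F θ hP g₀ os).shB K t x =
        gapCore2B₁₃ θ hP K₀ g₀ os (ρ F θ hP g₀ os) (ρ' F θ hP g₀ os) (n₁ F θ hP g₀ os) (n₂ F θ hP g₀ os) K t x :=
  ⟨gapWeight2A₁₃_sub_gapShell2A₁₃ θ hP K₀ g₀ os _ _ _ _ K t x, gapWeight2B₁₃_sub_gapShell2B₁₃ θ hP K₀ g₀ os _ _ _ _ K t x⟩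

end Dictionary2S

end Reading2S

end Summit.QuantumFields.YangMills.Theorems.N21GappedTopPair13CoPH

end
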